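import Summits.PneNP.PneNP.Theorems.ExpanderLinearGeneratorsLinearGeneratorDepthFregeHardDepthFloor
import Summits.PneNP.PneNP.Theorems.ExpanderLinearGeneratorsExpansionForcesDepthFregeSize
import Summits.PneNP.PneNP.Theorems.ExpanderLinearGeneratorsLinearGeneratorResolutionSize

/-!
# The locality floor of `LinearGeneratorDepthFregeHard` (route ExpanderLinearGenerators, rung 3)

Third helper file for item stmt-PneNP-11443
(`Summit.PneNP.PneNP.Theses.ExpanderLinearGenerators.LinearGeneratorDepthFregeHard`,
Krajíček's Problem 19.4.5 in universal-expander form).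

The item quantifies over every locality `ℓ ≥ 1`, every depth `d` and every `0 < δ < 1`. Two
degenerate corners hold for reasons unrelated to bounded-depth Frege lower bounds:

* depths `d ≤ 6`: no `textbookFrege` proof of alternation depth `≤ 6` refutes the XOR-CNF of an
  expanding unsolvable system (`not_isDepthProofOf_of_le_six`,
  `linearGeneratorDepthFregeHard_depth_le_six`, file `…DepthFregeHardDepthFloor.lean`);
* localities `ℓ ≤ 7` (this file): at unique-neighbour expansion `3/4 · ℓ` with `ℓ ≤ 7` every
  `ℓ`-sparse `(r, 3/4 · ℓ)`-boundary-expanding system with `r ≥ 1 + ℓ + ℓ²` is SOLVABLE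
  (`systemSat_of_isBoundaryExpander_of_le_seven`, proved for the sibling rung
  `ExpansionForcesDepthFregeSize` in `…ExpansionForcesDepthFregeSize.lean`), and the expansion
  scale `n^{1-δ}` exceeds `1 + ℓ + ℓ²` from `N = ⌈(1 + ℓ + ℓ²)^{1/(1-δ)}⌉` on
  (`le_rpow_of_ceil_le` of `…LinearGeneratorResolutionSize.lean`), so the
  unsolvability hypothesis is contradictory.

* `linearGeneratorDepthFregeHard_locality_le_seven` — the `ℓ ≤ 7` slice of the item.
* `linearGeneratorDepthFregeHard_iff_eight_le_and_seven_le` — the item is equivalent to its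
  restriction to `ℓ ≥ 8` and `d ≥ 7`: all of its content (Krajíček's open Problem 19.4.5, the
  AC⁰-Frege lower bound for expanding linear systems over `𝔽₂`) lives there.

References: J. Krajíček, *Proof Complexity* (CUP 2019), §13.3 and Problem 19.4.5
[KrajicekProofComplexity2019]; E. Ben-Sasson, A. Wigderson, J. ACM 48 (2001) §5
[BenSassonWigderson2001].
-/

namespace Summit.PneNP.PneNP.Theorems

set_option linter.dupNamespace false -- `Summit.PneNP.PneNP.…`: summit = sub-problem (D-0017)

open Literature.Computability.Complexity Literature.Computability.Complexity.PropForm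
open Literature.Computability.MetaComplexity

/-- **The `ℓ ≤ 7` slice of `LinearGeneratorDepthFregeHard` holds** (vacuously: with
`N = ⌈(1 + ℓ + ℓ²)^{1/(1-δ)}⌉` every `ℓ`-sparse `(n^{1-δ}, 3/4·ℓ)`-boundary-expanding system
over `𝔽₂` with `ℓ ≤ 7`, `n ≥ N` is solvable, by
`systemSat_of_isBoundaryExpander_of_le_seven`). The statement is the route decl
`Summit.PneNP.PneNP.Theses.ExpanderLinearGenerators.LinearGeneratorDepthFregeHard` with the extra
hypothesis `ℓ ≤ 7`. [folklore] -/
theorem linearGeneratorDepthFregeHard_locality_le_seven :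
    ∀ (ℓ d : ℕ) (δ : ℝ), 1 ≤ ℓ → 0 < δ → δ < 1 → ℓ ≤ 7 → ∃ ε : ℝ, 0 < ε ∧ ∃ N : ℕ, ∀ n : ℕ, N ≤ n →
      ∀ (m : ℕ) (E : Fin m → Literature.Computability.MetaComplexity.LinEqMod 2 n),
        (∀ i, (E i).supp.card ≤ ℓ) →
        Literature.Computability.MetaComplexity.IsBoundaryExpander
          (fun i => (E i).supp.map Fin.valEmbedding) ((n : ℝ) ^ (1 - δ)) (3 / 4 * ℓ) →
        ¬ Literature.Computability.MetaComplexity.SystemSat E Finset.univ →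
        ∀ π : List (Literature.Computability.Complexity.PropForm ℕ),
          Literature.Computability.MetaComplexity.textbookFrege.IsDepthProofOf d π
            (Literature.Computability.Complexity.PropForm.neg
              (Literature.Computability.Complexity.PropForm.ofCNF
                (Literature.Computability.MetaComplexity.sumEncoding 1 E))) →
          (2 : ℝ) ^ ((n : ℝ) ^ ε) ≤ (Literature.Computability.MetaComplexity.proofSize π : ℝ) := by
  intro ℓ d δ hℓ _hδ hδ1 hℓ7
  refine ⟨1, one_pos, ⌈((1 + ℓ + ℓ ^ 2 : ℕ) : ℝ) ^ (1 / (1 - δ))⌉₊,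
    fun n hn m E hsparse hexp hunsat π _hπ => ?_⟩
  have hr : (1 + ℓ + ℓ ^ 2 : ℝ) ≤ (n : ℝ) ^ (1 - δ) := by
    have := le_rpow_of_ceil_le (Nat.cast_nonneg (1 + ℓ + ℓ ^ 2)) (by linarith : 0 < 1 - δ) hn
    push_cast at this
    exact this
  exact absurd (systemSat_of_isBoundaryExpander_of_le_seven E hℓ hℓ7 hsparse hr hexp) hunsat

open Summit.PneNP.PneNP.Theses.ExpanderLinearGenerators in
/-- **Reduction of the crux to locality `≥ 8` and depth `≥ 7`.** Item stmt-PneNP-11443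
(`LinearGeneratorDepthFregeHard`, Krajíček's Problem 19.4.5 in universal-expander form) is
equivalent to its restriction to `ℓ ≥ 8` and `d ≥ 7`; the corners `ℓ ≤ 7` and `d ≤ 6` are
settled (vacuously) by `linearGeneratorDepthFregeHard_locality_le_seven` and
`linearGeneratorDepthFregeHard_depth_le_six`. [folklore] -/
theorem linearGeneratorDepthFregeHard_iff_eight_le_and_seven_le :
    LinearGeneratorDepthFregeHard ↔
    ∀ (ℓ d : ℕ) (δ : ℝ), 1 ≤ ℓ → 0 < δ → δ < 1 → 8 ≤ ℓ → 7 ≤ d →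
      ∃ ε : ℝ, 0 < ε ∧ ∃ N : ℕ, ∀ n : ℕ, N ≤ n →
      ∀ (m : ℕ) (E : Fin m → Literature.Computability.MetaComplexity.LinEqMod 2 n),
        (∀ i, (E i).supp.card ≤ ℓ) →
        Literature.Computability.MetaComplexity.IsBoundaryExpander
          (fun i => (E i).supp.map Fin.valEmbedding) ((n : ℝ) ^ (1 - δ)) (3 / 4 * ℓ) →
        ¬ Literature.Computability.MetaComplexity.SystemSat E Finset.univ →
        ∀ π : List (Literature.Computability.Complexity.PropForm ℕ),
          Literature.Computability.MetaComplexity.textbookFrege.IsDepthProofOf d π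
            (Literature.Computability.Complexity.PropForm.neg
              (Literature.Computability.Complexity.PropForm.ofCNF
                (Literature.Computability.MetaComplexity.sumEncoding 1 E))) →
          (2 : ℝ) ^ ((n : ℝ) ^ ε) ≤ (Literature.Computability.MetaComplexity.proofSize π : ℝ) := by
  refine ⟨fun h ℓ d δ hℓ hδ hδ1 _ _ => h ℓ d δ hℓ hδ hδ1, fun h ℓ d δ hℓ hδ hδ1 => ?_⟩
  by_cases hℓ8 : 8 ≤ ℓ
  · by_cases hd : 7 ≤ d
    · exact h ℓ d δ hℓ hδ hδ1 hℓ8 hd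
    · exact linearGeneratorDepthFregeHard_depth_le_six ℓ d δ hℓ hδ hδ1 (by omega)
  · exact linearGeneratorDepthFregeHard_locality_le_seven ℓ d δ hℓ hδ hδ1 (by omega)

end Summit.PneNP.PneNP.Theorems
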